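import Summits.QuantumFields.YangMills.Theses.TransverseWardBL
import Summits.QuantumFields.YangMills.Theorems.SoloInformedU1HelicityTorus
import Literature.MathematicalPhysics.QuantumFieldTheory.U1GinibreComparison
import Literature.MathematicalPhysics.QuantumFieldTheory.LatticeGaugeProofs
import Literature.Probability.LatticeModels.GinibreCharacterExpansion
import Literature.Probability.LatticeModels.BesselIRatioBounds
import HarnessLib

/-!
# Route `TransverseWardBL`, support `TorusMeanPlaqLower` (stmt-QuantumFields-22933): `⟨cos θ_p⟩_{Λ_{M+1},β} ≥ 9/10` for `β > 20`, every torus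

For Wilson `U(1)₄` on the torus `(ℤ/(M+1))⁴`: the mean plaquette `torusMeanPlaq β M` is at least `9/10` for every `β > 20` and EVERY
`M` (no large-volume proviso).  Proof (Ginibre + Bessel, as the planner's docstring says):
* §1 `torusMeanPlaq` is a Ginibre expectation with constant couplings `β` on the torus configuration group `U(1)^E`
  (lit `U1GinibreComparison.exp_neg_mul_wilsonAction_u1`);
* §2 the ONE-PLAQUETTE Ginibre expectation (couplings `β·1_{p₀}`) is `I₁(β)/I₀(β)` — character expansion
  (lit `GinibreCharacterExpansion.ginibreExpect_reChar_eq_tsum_div_tsum`), the dual sums collapsing to one term because the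
  plaquette character has infinite order on every torus of side `≥ 2` (§3, tested on `t ↦ e^{it}` placed on one link);
* Ginibre's monotonicity in the couplings (lit `ginibreExpect_reChar_mono`): torus `≥` one plaquette;
* lit `BesselIRatioBounds.besselI_div_besselI_zero_mem_Icc` (Amos): `I₁(x)/I₀(x) ≥ e^{−1/x} ≥ 19/20` for `x ≥ 20`;
* the side-1 torus (`M = 0`) is abelian-trivial: every plaquette holonomy is `1`.

Free-hands width seat `ym-t4-w11` (cell ym-fleet) for planner ym-idea-4 g9 (LINE g9-A).  THEOREMS ONLY; a one-point `U(1)` support of an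
abelian comparison line — nothing about the Yang–Mills mass gap is proved.

References: J. Ginibre, Comm. Math. Phys. **16** (1970) 310 [Ginibre1970]; A. Guth, Phys. Rev. D **21** (1980) 2291 [Guth1980];
D. E. Amos, Math. Comp. **28** (1974) 239 [Amos1974]; I. Montvay, G. Münster, *Quantum Fields on a Lattice* (1994) §3.2.7 [MontvayMunster1994].
-/

set_option autoImplicit false

noncomputable section

open MeasureTheory Filter Topology Finset
open scoped BigOperators
open Literature.MathematicalPhysics.QuantumFieldTheory Literature.MathematicalPhysics.QuantumLattice
open Literature.Probability.LatticeModels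
open Summit.QuantumFields.YangMills.Theorems.U1Helicity (torusMeanPlaq)

namespace Summit.QuantumFields.YangMills.Theorems.TransverseWardBL

/-! ## §1 The torus mean plaquette as a Ginibre expectation -/

/-- **`torusMeanPlaq` is a Ginibre expectation** with constant couplings `β` on the torus configuration group `U(1)^E`, of the real part of
the plaquette character at the origin. [cite: Ginibre1970, Example 4] -/
theorem torusMeanPlaq_eq_ginibreExpect (β : ℝ) (M : ℕ) :
    torusMeanPlaq β M =
      ginibreExpect (Measure.pi fun _ : Edge 4 (M + 1) => haarProbability Circle)
        (u1TorusChars M) (fun _ => β) (reChar (u1PlaqChar (0 : Site 4 (M + 1)) 0 1)) := by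
  have h1 : torusMeanPlaq β M =
      wilsonExpectation (L := M + 1) u1Rep β (reChar (u1PlaqChar (0 : Site 4 (M + 1)) 0 1)) := by
    unfold torusMeanPlaq
    congr 1
    funext U
    simp only [toTorusObservable_apply, plaquette_torusLift, torusProj_zero, reChar, u1PlaqChar_apply]
  rw [h1, wilsonExpectation_eq_div_integral u1Rep continuous_u1Rep, ginibreExpect]
  simp_rw [exp_neg_mul_wilsonAction_u1]
  set c := Real.exp (-β * Fintype.card (Plaquette 4 (M + 1)))
  have hc : c ≠ 0 := (Real.exp_pos _).ne'
  simp_rw [mul_left_comm _ c, integral_const_mul]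
  rw [mul_div_mul_left _ _ hc]

/-! ## §2 The one-plaquette Ginibre expectation is `I₁/I₀` -/

section OnePlaquette

variable {Ω : Type*} [CommGroup Ω] [TopologicalSpace Ω] [IsTopologicalGroup Ω] [CompactSpace Ω]
  [MeasurableSpace Ω] [BorelSpace Ω] {ι : Type*} [Fintype ι] [DecidableEq ι]

omit [IsTopologicalGroup Ω] [CompactSpace Ω] [MeasurableSpace Ω] [BorelSpace Ω] [DecidableEq ι] in
/-- In a product `∏ₐ (χₐ θ)^{nₐ}` with `n` supported at `a₀`, only the factor `a₀` survives. [folklore] -/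
theorem prod_zpow_eq_of_support (χ : ι → Ω →ₜ* Circle) (a₀ : ι) {n : ι → ℤ} (hn : ∀ a, a ≠ a₀ → n a = 0)
    (θ : Ω) : ∏ a, (χ a θ) ^ (n a) = (χ a₀ θ) ^ (n a₀) := by
  refine Finset.prod_eq_single a₀ (fun a _ ha => by rw [hn a ha, zpow_zero]) (fun h => absurd (Finset.mem_univ _) h)

open Classical in
/-- **The one-coupling Ginibre expectation of its own character**: if the character `χ_{a₀}` has infinite order
(`χ_{a₀}^k ≡ 1 ⇒ k = 0`), then with the couplings `β·1_{a₀}` one has `⟨Re χ_{a₀}⟩ = I₋₁(β)/I₀(β) = I₁(β)/I₀(β)`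
(the dual sums of the character expansion collapse to the single terms `n = −1_{a₀}` and `n = 0`).
[cite: MontvayMunster1994, §3.2.7 (3.169)–(3.172)] -/
theorem ginibreExpect_single_self (μ : Measure Ω) [μ.IsHaarMeasure] [IsProbabilityMeasure μ]
    (χ : ι → Ω →ₜ* Circle) (a₀ : ι) (β : ℝ) (hfree : ∀ k : ℤ, (∀ θ, (χ a₀ θ) ^ k = 1) → k = 0) :
    ginibreExpect μ χ (fun a => if a = a₀ then β else 0) (reChar (χ a₀)) = besselI (-1) β / besselI 0 β := by
  rw [ginibreExpect_reChar_eq_tsum_div_tsum]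
  set J : ι → ℝ := fun a => if a = a₀ then β else 0 with hJ
  have hJ0 : ∀ a, a ≠ a₀ → J a = 0 := fun a ha => by simp [hJ, ha]
  have hJa : J a₀ = β := by simp [hJ]
  -- if `n` is not supported at `a₀`, the dual weight vanishes
  have hoff : ∀ n : ι → ℤ, (¬ ∀ a, a ≠ a₀ → n a = 0) → ∏ b, besselI (n b) (J b) = 0 := by
    intro n h
    push Not at h
    obtain ⟨a, ha, hna⟩ := h
    exact prod_besselI_eq_zero_of_ne (hJ0 a ha) hna
  -- the dual weight of a multi-index supported at `a₀`
  have hon : ∀ n : ι → ℤ, (∀ a, a ≠ a₀ → n a = 0) → ∏ b, besselI (n b) (J b) = besselI (n a₀) β := by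
    intro n h
    rw [← hJa]
    refine Finset.prod_eq_single a₀ (fun a _ ha => ?_) (fun h' => absurd (Finset.mem_univ _) h')
    rw [h a ha, hJ0 a ha, besselI_zero_right, if_pos rfl]
  congr 1
  · -- numerator: only `n = −1_{a₀}` survives
    set n₁ : ι → ℤ := fun a => if a = a₀ then -1 else 0 with hn₁
    have hn₁off : ∀ a, a ≠ a₀ → n₁ a = 0 := fun a ha => by simp [hn₁, ha]
    rw [tsum_eq_single n₁]
    · have htw : twistChar χ (χ a₀) n₁ = 1 := by
        refine ContinuousMonoidHom.ext fun θ => ?_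
        show twistChar χ (χ a₀) n₁ θ = 1
        rw [twistChar_apply, prod_zpow_eq_of_support χ a₀ hn₁off θ]
        simp [hn₁]
      rw [if_pos htw, hon n₁ hn₁off]
      simp [hn₁]
    · intro n hn
      by_cases h : ∀ a, a ≠ a₀ → n a = 0
      · have hne : n a₀ ≠ -1 := by
          intro he
          apply hn
          funext a
          by_cases ha : a = a₀
          · subst ha; simp [hn₁, he]
          · rw [h a ha, hn₁off a ha]
        have htw : twistChar χ (χ a₀) n ≠ 1 := by
          intro heq
          have hall : ∀ θ, (χ a₀ θ) ^ (n a₀ + 1) = 1 := by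
            intro θ
            have hθ : twistChar χ (χ a₀) n θ = 1 := by rw [heq]; rfl
            rw [twistChar_apply, prod_zpow_eq_of_support χ a₀ h θ] at hθ
            rw [zpow_add_one, mul_comm]
            exact hθ
          have := hfree (n a₀ + 1) hall
          exact hne (by omega)
        rw [if_neg htw]
      · rw [hoff n h]; split_ifs <;> rfl
  · -- denominator: only `n = 0` survives
    rw [tsum_eq_single 0]
    · have htw : twistChar χ 1 (0 : ι → ℤ) = 1 := by
        refine ContinuousMonoidHom.ext fun θ => ?_
        show twistChar χ 1 (0 : ι → ℤ) θ = 1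
        rw [twistChar_apply]
        simp only [Pi.zero_apply, zpow_zero, Finset.prod_const_one, mul_one]
        rfl
      rw [if_pos htw, hon 0 (fun a _ => rfl)]
      rfl
    · intro n hn
      by_cases h : ∀ a, a ≠ a₀ → n a = 0
      · have hne : n a₀ ≠ 0 := by
          intro he
          apply hn
          funext a
          by_cases ha : a = a₀
          · subst ha; exact he
          · exact h a ha
        have htw : twistChar χ 1 n ≠ 1 := by
          intro heq
          have hall : ∀ θ, (χ a₀ θ) ^ (n a₀) = 1 := by
            intro θ
            have hθ : twistChar χ 1 n θ = 1 := by rw [heq]; rfl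
            rw [twistChar_apply, prod_zpow_eq_of_support χ a₀ h θ] at hθ
            have h1 : (1 : Ω →ₜ* Circle) θ = 1 := rfl
            rwa [h1, one_mul] at hθ
          exact hne (hfree (n a₀) hall)
        rw [if_neg htw]
      · rw [hoff n h]; split_ifs <;> rfl

end OnePlaquette

/-! ## §3 The plaquette character of a torus of side `≥ 2` has infinite order -/

/-- On the torus of side `M+1 ≥ 2` the plaquette holonomy `U ↦ U_{(0;0,1)}` takes every value `e^{it}`: test it on the
configuration equal to `e^{it}` on the link `(0, e₀)` and `1` elsewhere (the other three links of the plaquette are different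
links because `e₁ ≠ 0` in `(ℤ/(M+1))⁴`).  Hence `U_{p₀}^k ≡ 1` forces `k = 0` (take `t = π/k`). [folklore] -/
theorem u1PlaqChar_zpow_eq_one {M : ℕ} (hM : 1 ≤ M) (k : ℤ)
    (hk : ∀ U : GaugeConfig 4 (M + 1) Circle, (u1PlaqChar (0 : Site 4 (M + 1)) 0 1 U) ^ k = 1) : k = 0 := by
  by_contra hk0
  haveI : Fact (1 < M + 1) := ⟨by omega⟩
  set e₁ : Edge 4 (M + 1) := ((0 : Site 4 (M + 1)), (0 : Fin 4)) with he₁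
  set U₀ : GaugeConfig 4 (M + 1) Circle := Pi.mulSingle e₁ (Circle.exp (Real.pi / k)) with hU₀
  have hshift1 : ((0 : Site 4 (M + 1)).shift 1, (0 : Fin 4)) ≠ e₁ := by
    intro h
    have hfst : Literature.MathematicalPhysics.QuantumFieldTheory.Site.shift (0 : Site 4 (M + 1)) 1 =
        (0 : Site 4 (M + 1)) := by
      have := congrArg Prod.fst h; rw [he₁] at this; exact this
    have h1 : (Literature.MathematicalPhysics.QuantumFieldTheory.Site.shift (0 : Site 4 (M + 1)) 1) 1 =
        (0 : Site 4 (M + 1)) 1 := by rw [hfst]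
    simp [Literature.MathematicalPhysics.QuantumFieldTheory.Site.shift] at h1
  have hval : u1PlaqChar (0 : Site 4 (M + 1)) 0 1 U₀ = Circle.exp (Real.pi / k) := by
    rw [u1PlaqChar_apply, plaquetteHolonomy]
    have h2 : U₀ ((0 : Site 4 (M + 1)).shift 0, 1) = 1 := by
      rw [hU₀, Pi.mulSingle_eq_of_ne]
      intro h; exact absurd (congrArg Prod.snd h) (by simp [he₁])
    have h3 : U₀ ((0 : Site 4 (M + 1)).shift 1, 0) = 1 := by rw [hU₀, Pi.mulSingle_eq_of_ne hshift1]
    have h4 : U₀ ((0 : Site 4 (M + 1)), (1 : Fin 4)) = 1 := by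
      rw [hU₀, Pi.mulSingle_eq_of_ne]
      intro h; exact absurd (congrArg Prod.snd h) (by simp [he₁])
    have h1 : U₀ ((0 : Site 4 (M + 1)), (0 : Fin 4)) = Circle.exp (Real.pi / k) := by
      rw [hU₀, ← he₁, Pi.mulSingle_eq_same]
    rw [h1, h2, h3, h4]
    simp
  have h := hk U₀
  rw [hval] at h
  have h3 : ((Circle.exp (Real.pi / k) ^ k : Circle) : ℂ) = 1 := by rw [h, Circle.coe_one]
  rw [Circle.coe_zpow, Circle.coe_exp, ← Complex.exp_int_mul] at h3
  have h4 : (k : ℂ) * (((Real.pi / k : ℝ) : ℂ) * Complex.I) = Real.pi * Complex.I := by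
    have hk0' : (k : ℂ) ≠ 0 := by exact_mod_cast hk0
    push_cast
    field_simp
  rw [h4, Complex.exp_pi_mul_I] at h3
  norm_num at h3

/-! ## §4 Torus ≥ one plaquette ≥ `e^{−1/β}` -/

/-- **Ginibre: the torus mean plaquette dominates the one-plaquette mean** `I₁(β)/I₀(β)` (`β ≥ 0`, side `M + 1 ≥ 2`).
[cite: Ginibre1970, Prop. 3 with Example 4] -/
theorem besselRatio_le_torusMeanPlaq {β : ℝ} (hβ : 0 ≤ β) {M : ℕ} (hM : 1 ≤ M) :
    besselI (-1) β / besselI 0 β ≤ torusMeanPlaq β M := by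
  classical
  set p₀ : Plaquette 4 (M + 1) := ((0 : Site 4 (M + 1)), ⟨((0 : Fin 4), (1 : Fin 4)), by decide⟩) with hp₀
  have hχ : u1TorusChars M p₀ = u1PlaqChar (0 : Site 4 (M + 1)) 0 1 := rfl
  rw [torusMeanPlaq_eq_ginibreExpect, ← hχ,
    ← ginibreExpect_single_self (Measure.pi fun _ : Edge 4 (M + 1) => haarProbability Circle) (u1TorusChars M) p₀ β
      (fun k hk => u1PlaqChar_zpow_eq_one hM k (by rw [← hχ]; exact hk))]
  exact ginibreExpect_reChar_mono _ (fun θ => exists_mul_self_eq_u1Config θ) _ _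
    (fun a => by by_cases ha : a = p₀ <;> simp [ha, hβ]) (fun a => by by_cases ha : a = p₀ <;> simp [ha, hβ])

/-- **Amos' bound, numerically**: `I₁(β)/I₀(β) ≥ e^{−1/β} ≥ 19/20` for `β ≥ 20`. [cite: Amos1974, (9)–(11) p.241] -/
theorem besselRatio_ge {β : ℝ} (hβ : 20 ≤ β) : (9 / 10 : ℝ) ≤ besselI (-1) β / besselI 0 β := by
  have hβ0 : 0 < β := by linarith
  have h := (besselI_div_besselI_zero_mem_Icc hβ0 (-1)).1
  have hnat : ((-1 : ℤ).natAbs : ℝ) = 1 := by norm_num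
  rw [hnat] at h
  refine le_trans ?_ h
  have hexp : -(1 * (1 + 1) / (2 * β)) = -(1 / β) := by field_simp; ring
  rw [hexp]
  have h1 : -(1 / β) + 1 ≤ Real.exp (-(1 / β)) := Real.add_one_le_exp _
  have h2 : 1 / β ≤ 1 / 20 := one_div_le_one_div_of_le (by norm_num) hβ
  linarith

/-! ## §5 The side-1 torus -/

/-- On the one-site torus every `U(1)` plaquette holonomy is trivial (the plaquette reads the same two links twice with opposite
orientations), so the mean plaquette is `1`. [folklore] -/
theorem torusMeanPlaq_zero (β : ℝ) : torusMeanPlaq β 0 = 1 := by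
  haveI := isProbabilityMeasure_wilsonMeasure (d := 4) (L := 0 + 1) (G := Circle) u1Rep continuous_u1Rep β
  have hsub : ∀ x y : Site 4 (0 + 1), x = y := fun x y => funext fun i =>
    ZMod.val_injective _ (by have := ZMod.val_lt (x i); have := ZMod.val_lt (y i); omega)
  have hhol : ∀ U : GaugeConfig 4 (0 + 1) Circle, plaquetteHolonomy U (0 : Site 4 (0 + 1)) 0 1 = 1 := by
    intro U
    rw [plaquetteHolonomy, hsub ((0 : Site 4 (0 + 1)).shift 0) 0, hsub ((0 : Site 4 (0 + 1)).shift 1) 0]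
    simp [mul_comm, mul_left_comm]
  unfold torusMeanPlaq wilsonExpectation
  simp only [toTorusObservable_apply, plaquette_torusLift, torusProj_zero, hhol, Circle.coe_one, Complex.one_re,
    integral_const, smul_eq_mul, mul_one, probReal_univ]

/-! ## §6 The item -/

/-- **`TransverseWardBL.TorusMeanPlaqLower` (stmt-QuantumFields-22933) PROVED**: with `β₂ = 20`, for every `β > β₂` and EVERY torus side
`M + 1`, `torusMeanPlaq β M ≥ 9/10` (Ginibre's torus ≥ one-plaquette comparison, the one-plaquette mean `I₁(β)/I₀(β)` by the character
expansion, Amos' lower bound, and the trivial side-1 torus). [cite: Guth1980, §III] -/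
theorem torusMeanPlaqLower_proof : Summit.QuantumFields.YangMills.Theses.TransverseWardBL.TorusMeanPlaqLower := by
  refine ⟨20, fun β hβ M => ?_⟩
  rcases Nat.eq_zero_or_pos M with hM | hM
  · subst hM; rw [torusMeanPlaq_zero]; norm_num
  · exact (besselRatio_ge hβ.le).trans (besselRatio_le_torusMeanPlaq (by linarith) hM)

end Summit.QuantumFields.YangMills.Theorems.TransverseWardBL

end
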